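import Summits.Ventures.HodgeRepro2.T7SupportWeightTorusOrbital
import Summits.Ventures.HodgeRepro2.T7SupportDenseRegularPoint

/-!
# Continuity of the coefficients of a strongly continuous representation, and the density glue (support, seat p1)

The two records of t7-crit-1 on `T7SupportWeightTorusOrbital` (STATUS l. 15058 (i)–(ii)), typed:

* for a representation `τ` that is STRONGLY CONTINUOUS (`g ↦ τ(g) x` continuous for every `x` — automatic for
  a continuous finite-dimensional representation), every coefficient `coeff τ x y = ⟪y, τ(·) x⟫` is continuous
  (`continuous_coeff`), and so is the two-torus orbital integral as a function of `γ`
  (`continuous_torusOrbital`, `continuous_torusOrbital_conj`: they are `[…] · coeff (γ)` and `[…] · coeff (γ h)`);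
* hence the non-vanishing set of the orbital integral is open (`isOpen_torusOrbital_ne_zero`), and every
  dense subset `S ⊆ G` — the rational points under weak approximation, a PRINTED input — contains a `γ₀` at which
  the orbital integral is non-zero as soon as it is non-zero somewhere (`exists_mem_dense_torusOrbital_ne_zero`;
  with `T7SupportDenseRegularPoint.exists_mem_dense_ne_zero`), and a `γ₀` moreover outside any closed set `Z`
  with empty interior (`exists_mem_dense_torusOrbital_ne_zero_notMem` — the non-regular locus, when its
  nowhere-density is known: in the model rows 680/681, in general the identity theorem for the real-analytic
  coefficients of a finite-dimensional representation of a connected compact Lie group, printed).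

Nothing here is about any specific group, the adelic group, or any period.
Blind lane: Mathlib + the HodgeRepro2 prefix only; no sorry; axioms ⊆ {propext, Classical.choice, Quot.sound}.
-/

namespace Summit.Ventures.HodgeRepro2.T7SupportWeightTorusContinuous

open MeasureTheory Topology
open scoped InnerProductSpace
open T5HaarCircle T7SupportWeightTorusOrbital

variable {G : Type*} [Group G] [TopologicalSpace G] {V : Type*} [NormedAddCommGroup V]
  [InnerProductSpace ℂ V]

/-- strong continuity: `g ↦ τ(g) x` is continuous for every `x` -/
def IsStronglyContinuous (τ : G →* (V →ₗ[ℂ] V)) : Prop := ∀ x : V, Continuous fun g => τ g x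

/-- **the coefficients of a strongly continuous representation are continuous** -/
theorem continuous_coeff {τ : G →* (V →ₗ[ℂ] V)} (hc : IsStronglyContinuous τ) (x y : V) :
    Continuous (coeff τ x y) :=
  continuous_const.inner (hc x)

/-- `γ ↦ coeff (γ h)` is continuous (`[ContinuousMul G]`) -/
theorem continuous_coeff_mul_right [ContinuousMul G] {τ : G →* (V →ₗ[ℂ] V)} (hc : IsStronglyContinuous τ)
    (x y : V) (h : G) : Continuous fun γ => coeff τ x y (γ * h) :=
  (continuous_coeff hc x y).comp (continuous_id.mul continuous_const)

variable [MeasurableSpace Circle] [BorelSpace Circle]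

/-- **the two-torus orbital integral is continuous in `γ`** -/
theorem continuous_torusOrbital {τ : G →* (V →ₗ[ℂ] V)} (hτ : IsUnitaryRep τ) (hc : IsStronglyContinuous τ)
    {ρA ρB : Circle →* G} {a b : ℤ} {xA xB : V} (hA : IsWeightVector τ ρA a xA)
    (hB : IsWeightVector τ ρB b xB) (p q : ℤ) :
    Continuous fun γ : G => ∫ u : Circle, ∫ v : Circle,
      coeff τ xB xA (ρA u * γ * ρB v) * ((u : ℂ) ^ p * (starRingEnd ℂ) ((v : ℂ) ^ q))
      ∂haarCircle ∂haarCircle := by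
  have e : (fun γ : G => ∫ u : Circle, ∫ v : Circle,
      coeff τ xB xA (ρA u * γ * ρB v) * ((u : ℂ) ^ p * (starRingEnd ℂ) ((v : ℂ) ^ q))
      ∂haarCircle ∂haarCircle) =
      fun γ => (if a + p = 0 then 1 else 0) * (if b = q then 1 else 0) * coeff τ xB xA γ :=
    funext fun γ => torus_orbital_eq hτ hA hB γ p q
  rw [e]
  exact continuous_const.mul (continuous_coeff hc xB xA)

/-- **the orbital integral for the conjugated second torus is continuous in `γ`** -/
theorem continuous_torusOrbital_conj [ContinuousMul G] {τ : G →* (V →ₗ[ℂ] V)} (hτ : IsUnitaryRep τ)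
    (hc : IsStronglyContinuous τ) {ρA ρB : Circle →* G} {a b : ℤ} {xA xB : V}
    (hA : IsWeightVector τ ρA a xA) (hB : IsWeightVector τ ρB b xB) (h : G) (p q : ℤ) :
    Continuous fun γ : G => ∫ u : Circle, ∫ v : Circle,
      coeff τ (τ h xB) xA (ρA u * γ * (h * ρB v * h⁻¹)) * ((u : ℂ) ^ p * (starRingEnd ℂ) ((v : ℂ) ^ q))
      ∂haarCircle ∂haarCircle := by
  have e : (fun γ : G => ∫ u : Circle, ∫ v : Circle,
      coeff τ (τ h xB) xA (ρA u * γ * (h * ρB v * h⁻¹)) * ((u : ℂ) ^ p * (starRingEnd ℂ) ((v : ℂ) ^ q))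
      ∂haarCircle ∂haarCircle) =
      fun γ => (if a + p = 0 then 1 else 0) * (if b = q then 1 else 0) * coeff τ xB xA (γ * h) :=
    funext fun γ => torus_orbital_conj_eq hτ hA hB h γ p q
  rw [e]
  exact continuous_const.mul (continuous_coeff_mul_right hc xB xA h)

/-- the non-vanishing set of the (conjugated-torus) orbital integral is open -/
theorem isOpen_torusOrbital_ne_zero [ContinuousMul G] {τ : G →* (V →ₗ[ℂ] V)} (hτ : IsUnitaryRep τ)
    (hc : IsStronglyContinuous τ) {ρA ρB : Circle →* G} {a b : ℤ} {xA xB : V}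
    (hA : IsWeightVector τ ρA a xA) (hB : IsWeightVector τ ρB b xB) (h : G) (p q : ℤ) :
    IsOpen {γ : G | ∫ u : Circle, ∫ v : Circle,
      coeff τ (τ h xB) xA (ρA u * γ * (h * ρB v * h⁻¹)) * ((u : ℂ) ^ p * (starRingEnd ℂ) ((v : ℂ) ^ q))
      ∂haarCircle ∂haarCircle ≠ 0} :=
  T7SupportDenseRegularPoint.isOpen_ne_zero (continuous_torusOrbital_conj hτ hc hA hB h p q)

/-- **a dense subset contains a point with non-zero orbital integral** as soon as the orbital integral is
non-zero somewhere (e.g. at `γ = h⁻¹` for `x_B = x_A ≠ 0`, `torus_orbital_conj_at_inv_ne_zero`) -/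
theorem exists_mem_dense_torusOrbital_ne_zero [ContinuousMul G] {τ : G →* (V →ₗ[ℂ] V)} (hτ : IsUnitaryRep τ)
    (hc : IsStronglyContinuous τ) {ρA ρB : Circle →* G} {a b : ℤ} {xA xB : V}
    (hA : IsWeightVector τ ρA a xA) (hB : IsWeightVector τ ρB b xB) (h : G) (p q : ℤ) {S : Set G}
    (hS : Dense S)
    (hne : ∃ γ : G, ∫ u : Circle, ∫ v : Circle,
      coeff τ (τ h xB) xA (ρA u * γ * (h * ρB v * h⁻¹)) * ((u : ℂ) ^ p * (starRingEnd ℂ) ((v : ℂ) ^ q))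
      ∂haarCircle ∂haarCircle ≠ 0) :
    ∃ γ₀ ∈ S, ∫ u : Circle, ∫ v : Circle,
      coeff τ (τ h xB) xA (ρA u * γ₀ * (h * ρB v * h⁻¹)) * ((u : ℂ) ^ p * (starRingEnd ℂ) ((v : ℂ) ^ q))
      ∂haarCircle ∂haarCircle ≠ 0 :=
  T7SupportDenseRegularPoint.exists_mem_dense_ne_zero hS (continuous_torusOrbital_conj hτ hc hA hB h p q) hne

/-- the same with the point moreover outside a closed set `Z` of empty interior (the non-regular locus) -/
theorem exists_mem_dense_torusOrbital_ne_zero_notMem [ContinuousMul G] {τ : G →* (V →ₗ[ℂ] V)}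
    (hτ : IsUnitaryRep τ) (hc : IsStronglyContinuous τ) {ρA ρB : Circle →* G} {a b : ℤ} {xA xB : V}
    (hA : IsWeightVector τ ρA a xA) (hB : IsWeightVector τ ρB b xB) (h : G) (p q : ℤ) {S : Set G}
    (hS : Dense S)
    (hne : ∃ γ : G, ∫ u : Circle, ∫ v : Circle,
      coeff τ (τ h xB) xA (ρA u * γ * (h * ρB v * h⁻¹)) * ((u : ℂ) ^ p * (starRingEnd ℂ) ((v : ℂ) ^ q))
      ∂haarCircle ∂haarCircle ≠ 0) {Z : Set G} (hZc : IsClosed Z) (hZ : interior Z = ∅) :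
    ∃ γ₀ ∈ S, (∫ u : Circle, ∫ v : Circle,
      coeff τ (τ h xB) xA (ρA u * γ₀ * (h * ρB v * h⁻¹)) * ((u : ℂ) ^ p * (starRingEnd ℂ) ((v : ℂ) ^ q))
      ∂haarCircle ∂haarCircle ≠ 0) ∧ γ₀ ∉ Z :=
  T7SupportDenseRegularPoint.exists_mem_dense_ne_zero_notMem hS
    (continuous_torusOrbital_conj hτ hc hA hB h p q) hne hZc hZ

end Summit.Ventures.HodgeRepro2.T7SupportWeightTorusContinuous
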